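import Summits.Ventures.PercRepro.Night2StarSmall

/-!
# PercRepro — night-2: the pair `B ∪ {x, y}` of a basis `B` — coloops and bases (blind cell pub-perc-repro, night-2 gen 1)

For a basis `B` of a rank-`q` set `G` of a simple matroid and two points `x ≠ y` of `G ∖ B`, write `ncl(S) = S ∖ coloops(M|S)`
(the cyclic part) and `c_x = |ncl(B ∪ {x})|` (the size of the fundamental circuit of `x`). Lemma 2 of `proofs/NIGHT-2-star.md`:
* `mem_closure_of_mem_sdiff`, `notMem_coloopsOf_insert`, `not_indep_sdiff_coloopsOf_insert` — `x ∈ cl(B)`, `x` is not a coloop of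
  `B ∪ {x}`, the cyclic part of `B ∪ {x}` is dependent;
* `mem_closure_erase_of_coloop` — a coloop `w ∈ B` of `B ∪ {x}` has `x ∈ cl(B ∖ w)` (closure exchange);
* **`mem_coloopsOf_insert_insert`** — a point of `B` that is a coloop of both `B ∪ {x}` and `B ∪ {y}` is a coloop of `B ∪ {x, y}`;
* `mem_of_coloop_of_mem_bases` — a coloop of a spanning set lies in every basis inside it;
* `insert_insert_mem_SNq`, `mTr_insert_insert_le` (`m(B ∪ {x, y}) ≤ m(B ∪ {y})`), `insert_insert_sdiff`;
* **`bIn_insert_insert_le`** — `B ∪ {x, y}` holds at most `c_x · c_y` bases: a basis inside it misses a point of each fundamental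
  circuit (the injection `B′ ↦ (B ∪ {x, y}) ∖ B′` into the pairs of `C_x × C_y`).
Continued in `Night2StarTwoLong` (the arithmetic and the two-long-circuits case) and `Night2StarLongCount` (the count form and
the one-long-circuit case).
-/

namespace PercRepro.Star

open Finset ThmH SixFour GenQ

variable {α : Type*} [DecidableEq α] {M : Matroid α} [M.Finite]

/-! ## The cyclic part of a single -/

/-- `x ∈ G ∖ B` lies in the closure of the basis `B` of `G`. -/
theorem mem_closure_of_mem_sdiff {G B : Finset α} {q : ℕ} (hG : G ⊆ gr M)
    (hrG : M.eRk (G : Set α) = (q : ℕ∞)) (hB : B ∈ Bq M G q) {x : α} (hx : x ∈ G \ B) :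
    x ∈ M.closure (B : Set α) := by
  by_contra hcl
  obtain ⟨hSx, -⟩ := insert_mem_SNq hrG hB hx
  have hr := (mem_SNq.1 hSx).2.1
  have hrB := (mem_Bq.1 hB).2.1
  have hxE : x ∈ M.E := by
    rw [← coe_gr M]
    exact Finset.mem_coe.2 (hG (Finset.mem_sdiff.1 hx).1)
  have h := Matroid.eRk_insert_eq_add_one (M := M) (e := x) (X := (B : Set α)) ⟨hxE, hcl⟩
  rw [← Finset.coe_insert, hr, hrB] at h
  have h' : q = q + 1 := by exact_mod_cast h
  omega

/-- `x` is not a coloop of `B ∪ {x}`. -/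
theorem notMem_coloopsOf_insert {G B : Finset α} {q : ℕ} (hG : G ⊆ gr M)
    (hrG : M.eRk (G : Set α) = (q : ℕ∞)) (hB : B ∈ Bq M G q) {x : α} (hx : x ∈ G \ B) :
    x ∉ coloopsOf M (insert x B) := by
  intro h
  have h' := (mem_coloopsOf.1 h).2
  rw [Finset.erase_insert (Finset.mem_sdiff.1 hx).2] at h'
  exact h' (mem_closure_of_mem_sdiff hG hrG hB hx)

/-- The cyclic part of the single `B ∪ {x}` is dependent: it has rank `q − m` and `q + 1 − m` points. -/
theorem not_indep_sdiff_coloopsOf_insert {G B : Finset α} {q : ℕ} (hG : G ⊆ gr M)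
    (hrG : M.eRk (G : Set α) = (q : ℕ∞)) (hB : B ∈ Bq M G q) {x : α} (hx : x ∈ G \ B) :
    ¬ M.Indep (((insert x B) \ coloopsOf M (insert x B) : Finset α) : Set α) := by
  obtain ⟨hSx, hcx⟩ := insert_mem_SNq hrG hB hx
  obtain ⟨hSG, hr, -⟩ := mem_SNq.1 hSx
  intro hI
  have hsum := eRk_sdiff_add_card_eq_of_subset_coloopsOf (hSG.trans hG) (coloopsOf M (insert x B))
    (Finset.Subset.refl _)
  rw [hr, hI.eRk_eq_encard, Set.encard_coe_eq_coe_finsetCard,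
    Finset.card_sdiff_of_subset (coloopsOf_subset _), hcx] at hsum
  have hm : (coloopsOf M (insert x B)).card ≤ q + 1 := by
    have := Finset.card_le_card (coloopsOf_subset (M := M) (insert x B))
    rw [hcx] at this
    exact this
  have h' : (q + 1 - (coloopsOf M (insert x B)).card) + (coloopsOf M (insert x B)).card = q := by
    exact_mod_cast hsum
  omega

/-- A coloop of `B ∪ {x}` lying in `B` has `x ∈ cl(B ∖ w)`. -/
theorem mem_closure_erase_of_coloop {G B : Finset α} {q : ℕ} (hG : G ⊆ gr M)
    (hrG : M.eRk (G : Set α) = (q : ℕ∞)) (hB : B ∈ Bq M G q) {x w : α} (hx : x ∈ G \ B) (hw : w ∈ B)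
    (hc : w ∈ coloopsOf M (insert x B)) : x ∈ M.closure ((B.erase w : Finset α) : Set α) := by
  by_contra hcl
  have hxB := (Finset.mem_sdiff.1 hx).2
  have hwx : w ≠ x := fun h => hxB (h ▸ hw)
  have hxcl : x ∈ M.closure (insert w ((B.erase w : Finset α) : Set α)) := by
    rw [← Finset.coe_insert, Finset.insert_erase hw]
    exact mem_closure_of_mem_sdiff hG hrG hB hx
  have hex := Matroid.closure_exchange (M := M) (e := x) (f := w) (X := ((B.erase w : Finset α) : Set α))
    ⟨hxcl, hcl⟩
  apply (mem_coloopsOf.1 hc).2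
  rw [Finset.erase_insert_of_ne (Ne.symm hwx), Finset.coe_insert]
  exact hex.1

/-- **Lemma 2(a)**: a point of `B` that is a coloop of both singles `B ∪ {x}` and `B ∪ {y}` is a coloop of the pair
`B ∪ {x, y}`. -/
theorem mem_coloopsOf_insert_insert {G B : Finset α} {q : ℕ} (hG : G ⊆ gr M)
    (hrG : M.eRk (G : Set α) = (q : ℕ∞)) (hB : B ∈ Bq M G q) {x y w : α} (hx : x ∈ G \ B) (hy : y ∈ G \ B)
    (hw : w ∈ B) (hcx : w ∈ coloopsOf M (insert x B)) (hcy : w ∈ coloopsOf M (insert y B)) :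
    w ∈ coloopsOf M (insert x (insert y B)) := by
  have hxB := (Finset.mem_sdiff.1 hx).2
  have hyB := (Finset.mem_sdiff.1 hy).2
  have hwx : w ≠ x := fun h => hxB (h ▸ hw)
  have hwy : w ≠ y := fun h => hyB (h ▸ hw)
  have h1 := mem_closure_erase_of_coloop hG hrG hB hx hw hcx
  have h2 := mem_closure_erase_of_coloop hG hrG hB hy hw hcy
  rw [mem_coloopsOf]
  refine ⟨Finset.mem_insert_of_mem (Finset.mem_insert_of_mem hw), ?_⟩
  rw [Finset.erase_insert_of_ne (Ne.symm hwx), Finset.erase_insert_of_ne (Ne.symm hwy), Finset.coe_insert,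
    Finset.coe_insert]
  have h2' : y ∈ M.closure ((B.erase w : Finset α) : Set α) := h2
  rw [Matroid.closure_insert_eq_of_mem_closure (M.closure_subset_closure (Set.subset_insert y _) h1),
    Matroid.closure_insert_eq_of_mem_closure h2']
  have hind := indep_of_eRk_eq_of_card_eq (mem_Bq.1 hB).2.1 (mem_Bq.1 hB).2.2
  have := hind.notMem_closure_sdiff_of_mem (Finset.mem_coe.2 hw)
  rw [← Finset.coe_erase] at this
  exact this

/-- A coloop of a spanning set lies in every basis of `G` inside it. -/
theorem mem_of_coloop_of_mem_bases {G S B' : Finset α} {q : ℕ} (hG : G ⊆ gr M) (hS : S ⊆ G)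
    (hr : M.eRk (S : Set α) = (q : ℕ∞)) (hB' : B' ∈ Bq M G q) (hB'S : B' ⊆ S) {w : α}
    (hw : w ∈ coloopsOf M S) : w ∈ B' := by
  by_contra hwB
  have hwS := (mem_coloopsOf.1 hw).1
  have hstep := eRk_erase_add_one_of_notMem_closure (hS.trans hG) hwS (mem_coloopsOf.1 hw).2
  have hsub : B' ⊆ S.erase w := fun z hz => Finset.mem_erase.2 ⟨fun h => hwB (h ▸ hz), hB'S hz⟩
  have hle := M.eRk_mono (Finset.coe_subset.2 hsub)
  rw [(mem_Bq.1 hB').2.1] at hle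
  rw [hr] at hstep
  obtain ⟨k, hk⟩ := exists_eRk_eq_nat (M := M) (S.erase w)
  rw [hk] at hle hstep
  have h1 : q ≤ k := by exact_mod_cast hle
  have h2 : k + 1 = q := by exact_mod_cast hstep
  omega

/-! ## The pair `B ∪ {x, y}` -/

/-- `B ∪ {x, y}` is a spanning non-basis of `G` with `q + 2` points. -/
theorem insert_insert_mem_SNq {G B : Finset α} {q : ℕ} (hrG : M.eRk (G : Set α) = (q : ℕ∞))
    (hB : B ∈ Bq M G q) {x y : α} (hx : x ∈ G \ B) (hy : y ∈ G \ B) (hxy : x ≠ y) :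
    insert x (insert y B) ∈ SNq M G q ∧ (insert x (insert y B)).card = q + 2 := by
  obtain ⟨hBG, hrB, hBq⟩ := mem_Bq.1 hB
  have hxG := (Finset.mem_sdiff.1 hx).1
  have hxB := (Finset.mem_sdiff.1 hx).2
  have hyG := (Finset.mem_sdiff.1 hy).1
  have hyB := (Finset.mem_sdiff.1 hy).2
  have hsub : insert x (insert y B) ⊆ G := Finset.insert_subset hxG (Finset.insert_subset hyG hBG)
  have hxyB : x ∉ insert y B := by
    rw [Finset.mem_insert, not_or]
    exact ⟨hxy, hxB⟩
  have hcard : (insert x (insert y B)).card = q + 2 := by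
    rw [Finset.card_insert_of_notMem hxyB, Finset.card_insert_of_notMem hyB, hBq]
  have hr : M.eRk ((insert x (insert y B) : Finset α) : Set α) = (q : ℕ∞) := by
    apply le_antisymm
    · have := M.eRk_mono (Finset.coe_subset.2 hsub)
      rw [hrG] at this
      exact this
    · have := M.eRk_mono (Finset.coe_subset.2 ((Finset.subset_insert y B).trans (Finset.subset_insert x _)))
      rw [hrB] at this
      exact this
  refine ⟨mem_SNq.2 ⟨hsub, hr, ?_⟩, hcard⟩
  omega

/-- `m(B ∪ {x, y}) ≤ m(B ∪ {y})`: a coloop of the pair is a coloop of the single (it is never `x`). -/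
theorem mTr_insert_insert_le {G B : Finset α} {q : ℕ} (hG : G ⊆ gr M)
    (hrG : M.eRk (G : Set α) = (q : ℕ∞)) (hB : B ∈ Bq M G q) {x y : α} (hx : x ∈ G \ B)
    (hxy : x ≠ y) : mTr M (insert x (insert y B)) ≤ mTr M (insert y B) := by
  unfold mTr
  apply Finset.card_le_card
  intro w hw
  have hwS := (mem_coloopsOf.1 hw).1
  have hwx : w ≠ x := by
    intro h
    subst h
    apply (mem_coloopsOf.1 hw).2
    have hxyB : w ∉ insert y B := by
      rw [Finset.mem_insert, not_or]
      exact ⟨hxy, (Finset.mem_sdiff.1 hx).2⟩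
    rw [Finset.erase_insert hxyB]
    exact M.closure_subset_closure (Finset.coe_subset.2 (Finset.subset_insert y B))
      (mem_closure_of_mem_sdiff hG hrG hB hx)
  have hw' : w ∈ insert y B := by
    rcases Finset.mem_insert.1 hwS with h | h
    · exact absurd h hwx
    · exact h
  exact mem_coloopsOf_of_subset (Finset.subset_insert x (insert y B)) hw' hw

/-- `(B ∪ {x, y}) ∖ B = {x, y}`. -/
theorem insert_insert_sdiff {B : Finset α} {x y : α} (hx : x ∉ B) (hy : y ∉ B) :
    insert x (insert y B) \ B = {x, y} := by
  ext z
  simp only [Finset.mem_sdiff, Finset.mem_insert, Finset.mem_singleton]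
  constructor
  · rintro ⟨h1 | h1 | h1, h2⟩
    · exact Or.inl h1
    · exact Or.inr h1
    · exact absurd h1 h2
  · rintro (rfl | rfl)
    · exact ⟨Or.inl rfl, hx⟩
    · exact ⟨Or.inr (Or.inl rfl), hy⟩

/-- **Lemma 2(c), crude form**: `B ∪ {x, y}` holds at most `c_x · c_y` bases of `G`, where `c_x = |ncl(B ∪ {x})|`
is the size of the fundamental circuit of `x`: a basis inside `B ∪ {x, y}` misses a point of each circuit. -/
theorem bIn_insert_insert_le {G B : Finset α} {q : ℕ} (hG : G ⊆ gr M)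
    (hrG : M.eRk (G : Set α) = (q : ℕ∞)) (hB : B ∈ Bq M G q) {x y : α} (hx : x ∈ G \ B) (hy : y ∈ G \ B)
    (hxy : x ≠ y) :
    bIn M G q (insert x (insert y B)) ≤
      ((insert x B) \ coloopsOf M (insert x B)).card * ((insert y B) \ coloopsOf M (insert y B)).card := by
  set S := insert x (insert y B) with hS
  set Cx := (insert x B) \ coloopsOf M (insert x B) with hCx
  set Cy := (insert y B) \ coloopsOf M (insert y B) with hCy
  obtain ⟨hSmem, hScard⟩ := insert_insert_mem_SNq hrG hB hx hy hxy
  obtain ⟨hSG, hrS, -⟩ := mem_SNq.1 hSmem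
  have hxB := (Finset.mem_sdiff.1 hx).2
  have hyB := (Finset.mem_sdiff.1 hy).2
  have hxS : insert x B ⊆ S := Finset.insert_subset_insert x (Finset.subset_insert y B)
  have hyS : insert y B ⊆ S := Finset.subset_insert x _
  -- the injection `B' ↦ S ∖ B'` into the pairs `{a, b}`, `a ∈ Cx`, `b ∈ Cy`
  have hinj : Set.InjOn (fun B' : Finset α => S \ B') ((Bq M G q).filter (fun B' : Finset α => B' ⊆ S)) := by
    intro B1 h1 B2 h2 heq
    have h1' := (Finset.mem_filter.1 (Finset.mem_coe.1 h1)).2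
    have h2' := (Finset.mem_filter.1 (Finset.mem_coe.1 h2)).2
    simp only at heq
    rw [← Finset.sdiff_sdiff_eq_self h1', heq, Finset.sdiff_sdiff_eq_self h2']
  have himg : ((Bq M G q).filter (fun B' : Finset α => B' ⊆ S)).image (fun B' : Finset α => S \ B') ⊆
      (Cx ×ˢ Cy).image (fun p : α × α => ({p.1, p.2} : Finset α)) := by
    intro P hP
    rw [Finset.mem_image] at hP
    obtain ⟨B', hB', rfl⟩ := hP
    rw [Finset.mem_filter] at hB'
    obtain ⟨hB'q, hB'S⟩ := hB'
    have hind := indep_of_eRk_eq_of_card_eq (mem_Bq.1 hB'q).2.1 (mem_Bq.1 hB'q).2.2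
    have hcard2 : (S \ B').card = 2 := by
      rw [Finset.card_sdiff_of_subset hB'S, hScard, (mem_Bq.1 hB'q).2.2]
      omega
    -- a point of each circuit outside `B'`
    have hu : ∃ u ∈ Cx, u ∉ B' := by
      by_contra hcon
      push Not at hcon
      have hsub : Cx ⊆ B' := fun z hz => hcon z hz
      exact not_indep_sdiff_coloopsOf_insert hG hrG hB hx (hind.subset (Finset.coe_subset.2 hsub))
    have hv : ∃ v ∈ Cy, v ∉ B' := by
      by_contra hcon
      push Not at hcon
      have hsub : Cy ⊆ B' := fun z hz => hcon z hz
      exact not_indep_sdiff_coloopsOf_insert hG hrG hB hy (hind.subset (Finset.coe_subset.2 hsub))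
    obtain ⟨u, huC, huB'⟩ := hu
    obtain ⟨v, hvC, hvB'⟩ := hv
    have huS : u ∈ S := hxS (Finset.mem_sdiff.1 huC).1
    have hvS : v ∈ S := hyS (Finset.mem_sdiff.1 hvC).1
    have huP : u ∈ S \ B' := Finset.mem_sdiff.2 ⟨huS, huB'⟩
    have hvP : v ∈ S \ B' := Finset.mem_sdiff.2 ⟨hvS, hvB'⟩
    rw [Finset.mem_image]
    by_cases huv : u = v
    · -- `S ∖ B' = {u, w}`; `w` lies in a circuit, else it is a coloop of `S`
      obtain ⟨p, r, hpr, hP⟩ := Finset.card_eq_two.1 hcard2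
      have hmemP : ∀ z, z ∈ S \ B' ↔ z = p ∨ z = r := by
        intro z
        rw [hP]
        simp
      obtain ⟨w, hwP, hwu⟩ : ∃ w ∈ S \ B', w ≠ u := by
        rcases (hmemP u).1 huP with h | h
        · exact ⟨r, (hmemP r).2 (Or.inr rfl), fun h' => hpr (h ▸ h'.symm ▸ rfl)⟩
        · exact ⟨p, (hmemP p).2 (Or.inl rfl), fun h' => hpr (h' ▸ h ▸ rfl)⟩
      have hPeq : S \ B' = {u, w} := by
        apply (Finset.eq_of_subset_of_card_le ?_ ?_).symm
        · intro z hz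
          simp only [Finset.mem_insert, Finset.mem_singleton] at hz
          rcases hz with rfl | rfl
          · exact huP
          · exact hwP
        · rw [hcard2, Finset.card_pair (Ne.symm hwu)]
      have hwS := (Finset.mem_sdiff.1 hwP).1
      have hwB' := (Finset.mem_sdiff.1 hwP).2
      have hw : w ∈ Cx ∨ w ∈ Cy := by
        by_contra hcon
        push Not at hcon
        rcases Finset.mem_insert.1 hwS with rfl | hw'
        · exact hcon.1 (Finset.mem_sdiff.2 ⟨Finset.mem_insert_self _ _, notMem_coloopsOf_insert hG hrG hB hx⟩)
        · rcases Finset.mem_insert.1 hw' with rfl | hwB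
          · exact hcon.2 (Finset.mem_sdiff.2 ⟨Finset.mem_insert_self _ _, notMem_coloopsOf_insert hG hrG hB hy⟩)
          · have hcx : w ∈ coloopsOf M (insert x B) := by
              by_contra h
              exact hcon.1 (Finset.mem_sdiff.2 ⟨Finset.mem_insert_of_mem hwB, h⟩)
            have hcy : w ∈ coloopsOf M (insert y B) := by
              by_contra h
              exact hcon.2 (Finset.mem_sdiff.2 ⟨Finset.mem_insert_of_mem hwB, h⟩)
            have hcS := mem_coloopsOf_insert_insert hG hrG hB hx hy hwB hcx hcy
            exact hwB' (mem_of_coloop_of_mem_bases hG hSG hrS hB'q hB'S hcS)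
      rcases hw with hwC | hwC
      · refine ⟨(w, u), Finset.mem_product.2 ⟨hwC, huv ▸ hvC⟩, ?_⟩
        show ({w, u} : Finset α) = S \ B'
        rw [hPeq, Finset.pair_comm]
      · refine ⟨(u, w), Finset.mem_product.2 ⟨huC, hwC⟩, ?_⟩
        show ({u, w} : Finset α) = S \ B'
        rw [hPeq]
    · refine ⟨(u, v), Finset.mem_product.2 ⟨huC, hvC⟩, ?_⟩
      show ({u, v} : Finset α) = S \ B'
      apply Finset.eq_of_subset_of_card_le
      · intro z hz
        simp only [Finset.mem_insert, Finset.mem_singleton] at hz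
        rcases hz with rfl | rfl
        · exact huP
        · exact hvP
      · rw [hcard2, Finset.card_pair huv]
  unfold bIn
  calc ((Bq M G q).filter (fun B' : Finset α => B' ⊆ S)).card
      = (((Bq M G q).filter (fun B' : Finset α => B' ⊆ S)).image (fun B' : Finset α => S \ B')).card :=
        (Finset.card_image_of_injOn hinj).symm
    _ ≤ ((Cx ×ˢ Cy).image (fun p : α × α => ({p.1, p.2} : Finset α))).card := Finset.card_le_card himg
    _ ≤ (Cx ×ˢ Cy).card := Finset.card_image_le
    _ = Cx.card * Cy.card := Finset.card_product _ _


end PercRepro.Star
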